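import Literature.Analysis.FluidPDE.KNSSThm53OfWindow
import Literature.Analysis.FluidPDE.KNSSBlowupLimit
import Literature.Analysis.FluidPDE.LeiZhang2011RegularityProofs
import HarnessLib

/-!
# Lei–Zhang 2011, Theorem 1.4, Case 1: the axisymmetric blow-up limit vanishes once its swirl
# is removed

Analysis/FluidPDE **proofs file** (theorems only: no definitions, no named facts, no `sorry`) on
the discharge path of the named fact
`Literature.Analysis.FluidPDE.LeiZhang2011_regularity_bmoStream` (Z. Lei, Q. S. Zhang,
J. Funct. Anal. 261 (2011) = arXiv:1011.5066, **Theorem 1.4**, proof §4, Case 1, p. 12).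

Case 1 of the printed proof (`r_k Q_k` bounded): the blow-up limit `u` "is also axi-symmetric
… the stream function of `u` is in BMO and `r u^θ` is also bounded. Therefore we can apply
Theorem 1.1 on `u`, which says that the swirl component of `u` vanishes. By Theorem 5.2 in [KNSS],
we conclude `u = (0, 0, l(t))` … But this show `u = 0` as in the proof of the previous theorem.
This contradiction shows that Case 1 can not happen." This file proves everything after the
application of Theorem 1.1, for the limit object:

* `case1_limit_eq_zero_of_hasNoSwirl` — a bounded weak solution `v` on `ℝ³ × (−∞, 0)` (KNSS
  class), jointly continuous, with axisymmetric **swirl-free** slices, each slice having a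
  distributional stream function of finite `BMO` seminorm (the output of
  `exists_bmoStream_of_tendstoUniformlyOn`, `LeiZhang2011LimitStream`), vanishes on
  `(−∞, 0] × ℝ³`: KNSS Thm. 5.2 (`KNSS2009_liouville_axisymmetric_no_swirl_holds`, proved in the
  tree) gives `v(t) = b(t) e_z` a.e. for a.e. `t`; the distributional endgame
  `eq_zero_of_forall_integral_mul_inner_eq` (`LeiZhang2011RegularityProofs`) kills `b(t) e_z`;
  continuity reaches every point up to `t = 0` (`forall_eq_zero_of_ae_slice_eq_zero`).

The removal of the swirl itself is Theorem 1.1 of the paper (Hölder continuity of `Γ` at the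
axis for drifts in the class `E`, applied at all scales), not in the tree; in the assembly of
Theorem 1.4 it enters as the explicit swirl-step hypothesis.

## Mathlib / tree search

Reused: `KNSS2009_liouville_axisymmetric_no_swirl_holds` (`KNSSThm53OfWindow`) with
`KNSS2009_liouville_axisymmetric_no_swirl.of_pointwise` (`KNSSLiouville`),
`eq_zero_of_forall_integral_mul_inner_eq` (`LeiZhang2011RegularityProofs`),
`forall_eq_zero_of_ae_slice_eq_zero` (`KNSSBlowupLimit`).

## References

* Z. Lei, Q. S. Zhang, J. Funct. Anal. 261 (2011) = arXiv:1011.5066: Thm. 1.4, proof §4, Case 1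
  (p. 12); Thm. 1.2, proof §4 (p. 12). [LeiZhang2011]
* G. Koch, N. Nadirashvili, G. Seregin, V. Šverák, Acta Math. 203 (2009) = arXiv:0709.3599,
  Thm. 5.2 (pp. 9–10). [KochNadirashviliSereginSverak2009]
-/

noncomputable section

open MeasureTheory Set Function Filter Topology TopologicalSpace Metric
open scoped InnerProductSpace RealInnerProductSpace NNReal ENNReal

namespace Literature.Analysis.FluidPDE

open Literature.Analysis.FunctionSpaces

/-- **Lei–Zhang 2011, Theorem 1.4, Case 1 after Theorem 1.1 — the limit vanishes.** Let `v` be a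
bounded weak solution of Navier–Stokes (`ν = 1`) on `ℝ³ × (−∞, 0)`, jointly continuous, with
axisymmetric and swirl-free slices, such that every slice `v(t, ·)`, `t < 0`, has a distributional
stream function of finite `BMO` seminorm: a locally integrable `B_t` with `‖B_t‖_{BMO} < ∞` and
`∫ φ ⟪v(t), e⟫ = ∫ ⟪B_t × ∇φ, e⟫` for `φ ∈ C¹_c`. Then `v = 0` on `(−∞, 0] × ℝ³`.
[cite: LeiZhang2011, Thm. 1.4, proof §4, Case 1 (arXiv p. 12)] -/
theorem case1_limit_eq_zero_of_hasNoSwirl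
    {v : ℝ → EuclideanSpace ℝ (Fin 3) → EuclideanSpace ℝ (Fin 3)}
    (hweak : IsBoundedWeakNSSolutionOn (Iio 0) isOpen_Iio 1 v) (hvcont : Continuous (uncurry v))
    (haxi : ∀ t < 0, IsAxisymmetric (v t)) (hnoswirl : ∀ t < 0, HasNoSwirl (v t))
    (hstream : ∀ t < 0, ∃ Bt : EuclideanSpace ℝ (Fin 3) → EuclideanSpace ℝ (Fin 3),
      LocallyIntegrable Bt volume ∧ eBMOSeminormVec Bt < ∞ ∧
      ∀ (φ : EuclideanSpace ℝ (Fin 3) → ℝ) (e : EuclideanSpace ℝ (Fin 3)),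
        ContDiff ℝ 1 φ → HasCompactSupport φ →
          ∫ x, φ x * ⟪v t x, e⟫ = ∫ x, ⟪cross (Bt x) (gradient φ x), e⟫) :
    ∀ t ≤ 0, ∀ x, v t x = 0 := by
  -- KNSS Theorem 5.2: `v(t) = b(t) e_z` a.e., for a.e. `t < 0`
  obtain ⟨b, -, -, hae⟩ :=
    KNSS2009_liouville_axisymmetric_no_swirl_holds.of_pointwise hweak haxi hnoswirl
  -- the endgame at a.e. time
  have hzero : ∀ᵐ t ∂(volume.restrict (Iio (0 : ℝ))), v t =ᵐ[volume] 0 := by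
    filter_upwards [hae, ae_restrict_mem measurableSet_Iio] with t ht ht0
    obtain ⟨Bt, hBi, hBMO, hid⟩ := hstream t ht0
    have hc : b t • eZ = 0 := by
      refine eq_zero_of_forall_integral_mul_inner_eq hBi hBMO fun φ e hφ hφc => ?_
      rw [← hid φ e (contDiff_infty.1 hφ 1) hφc]
      refine integral_congr_ae ?_
      filter_upwards [ht] with x hx
      rw [hx]
    rw [hc] at ht
    exact ht
  exact forall_eq_zero_of_ae_slice_eq_zero hvcont hzero

end Literature.Analysis.FluidPDE
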